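import Literature.MathematicalPhysics.QuantumFieldTheory.Balaban1983to89.TraceWordsSeparateOrbitsOrthogonal
import Literature.LinearAlgebra.Matrix.PfaffianCongruence
import HarnessLib

/-!
# CENSUS NEGATIVE: word traces of the natural representation do NOT separate simultaneous-conjugation orbits in `SO(2m)`,
# `m ≥ 1`, and the density schema `TraceWordsDense` FAILS there — the Pfaffian of the skew projection is an
# `SO(2m)`-invariant that traces of words cannot see ([AslaksenTanZhu1995] §1, Thm 3; scope of [Sengupta1994] Thm 2 and
# of [Levy2004] Abstract p.2)

statement-level skeleton of published theorems with citation tags; proofs where landed; nothing here is a claim about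
the Yang–Mills mass gap

Companion of `TraceWordsSeparateOrbitsOrthogonal` (`O(N)`, every `N`; `SO(N)`, `N` odd) and `…Symplectic` (`Sp(n)`), which
PROVE module XXI's orbit-separation schema `TraceWordsSeparateOrbits ρ` for the natural representations on Sengupta's /
Lévy's lists; module XXI refutes it for the rotation representation `so2Rep` of `U(1) ≅ SO(2)`.  This file refutes it for
ALL even special orthogonal groups `SO(2m)`, `m ≥ 1`, in the standard representation `specialOrthogonalRep (Fin 2m)`, and
refutes the several-variable density schema `TraceWordsDense` of module XX for them.

THE PRINT.  [AslaksenTanZhu1995] = H. Aslaksen, E.-C. Tan, C.-B. Zhu, *Invariant theory of special orthogonal groups*,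
Pacific J. Math. 168 (1995) 207–215 (held `paper:doi-10-2140-pjm-1995-168-207`), §1 p.207: «If A is a skewsymmetric
2k × 2k matrix over F, we denote the Pfaffian of A by pf A. It satisfies det A = pf² A and pf(gAgᵗ) = det g pf A. For an
arbitrary 2k × 2k matrix M, we define p̃f(M) = pf(M − Mᵗ) to be the Pfaffian of the skewsymmetric projection of M. This
is clearly an SO(2k, F) invariant. … We will see that for n odd we do not get any more invariants when we restrict
O(n, F) to SO(n, F).»; Thm 3 p.209: «When G = SO(2k+1, F), the invariants P[W(2k+1, m, F)]^G are the same as the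
O(2k+1, F) invariants. When G = SO(2k, F), the invariants P[W(2k, m, F)]^G are generated by traces and polarized
Pfaffians».  Consistently, [Sengupta1994] Thm 2 lists «the odd special orthogonal groups SO(2n+1)» only, and [Levy2004]'s
Abstract asserts the natural representation suffices for «orthogonal, unitary or symplectic» `G` (= `O(n)`, `U(n)`, `Sp(n)`).

WHAT IS PROVED HERE (kernel-checked; `N = m + m`, `m ≥ 1`, `G = SO(N) = Matrix.specialOrthogonalGroup (Fin N) ℝ`,
`ρ = specialOrthogonalRep (Fin N)` of `TraceWordsSeparateOrbitsOrthogonal`):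
* §1 the PFAFFIAN OF THE SKEW PROJECTION `p̃f(X) = pf(X − Xᵀ)` (tree's `Literature.LinearAlgebra.Matrix.pfaffian`):
  `pfaffianSkew_conj` — `p̃f(g X g⁻¹) = det g · p̃f(X)` for `g ∈ O(N)` (from the tree's `pfaffian_mul_mul_transpose`,
  Goodman–Wallach (B.15)); so it is an `SO(N)`-invariant and changes SIGN under the reflections of `O(N) ∖ SO(N)`;
  `continuous_pfaffian` (Laplace expansion, induction).
* §2 the witness: `g₀ = realJ m ∈ SO(2m)` — Mathlib's `Matrix.J (Fin m) ℝ = (0 −I; I 0)` re-indexed to `Fin (m+m)`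
  (orthogonal since `J² = −1`, `det J = 1` by Mathlib's `SymplecticGroup.det_eq_one`) — has `p̃f(g₀) = pf(2 g₀) ≠ 0`
  (`det(2g₀) = 2^{2m} ≠ 0` and `det = pf²`); the reflection `P = diag(−1, 1, …, 1)` gives `g₁ = P g₀ P ∈ SO(2m)` with
  THE SAME TRACES OF ALL WORDS (`g₁ = P g₀ P⁻¹` inside `O(2m)`; `tracePart_wordVal_reflFamily`) and `p̃f(g₁) = −p̃f(g₀)`.
* §3 **`not_traceWordsSeparateOrbits_specialOrthogonalGroup_even`**: for every even `N ≥ 2`,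
  `¬ TraceWordsSeparateOrbits (specialOrthogonalRep (Fin N))` — already ONE letter (`ι = Unit`) fails: `g₀`, `g₁` have
  equal word traces and are not conjugate in `SO(N)` (a conjugator `k` would give `p̃f(g₁) = det k · p̃f(g₀) = p̃f(g₀)`).
* §4 **`not_traceWordsDense_specialOrthogonalGroup_even`**: for every even `N ≥ 2`, `¬ TraceWordsDense
  (specialOrthogonalRep (Fin N))` — the continuous conjugation-invariant `V ↦ p̃f(V)` on `SO(N)^{Unit}` takes the values
  `±c`, `c ≠ 0`, at `g₀`, `g₁`, where every polynomial in the word traces takes equal values.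

HONEST SCOPE.  This is a statement about the NATURAL representation only: with all irreducible characters (Lévy's
Thm 3.1) or with the polarized Pfaffians added (Aslaksen–Tan–Zhu Thm 3) separation/density hold — not formalised.  Nothing
is said about `SpansGaugeInvariantCylinders` on `ℤ^d` for `SO(2m)` (module XX's lattice negative
`not_spansGaugeInvariantCylinders_so2Rep` covers `SO(2) ≅ U(1)` only), nor about torus states; NOT summit progress.
Cell context: lit-balaban (HOME `run/shared/lean/pub/lit-balaban/`), unit p24 gen 19, free-target protocol G.5-34(d); the
kernel form of the reading note in pub-balaban `ir/SUFFICIENT.md` §25 (e) («for SO(2n) in its natural representation the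
density FAILS (reflection conjugation) … load-bearing for no kernel statement»); no SKELETON row.
-/

namespace Literature.MathematicalPhysics.QuantumFieldTheory.Balaban1983to89.TraceWordsSeparateOrbitsEvenOrthogonal

open Literature.MathematicalPhysics.QuantumLattice
open Balaban1983to89.Missing (TraceWordsSeparateOrbits TraceWordsDense)
open TraceWordsSeparateOrbitsOrthogonal (orthogonalRep specialOrthogonalRep)
open Literature.LinearAlgebra.Matrix (pfaffian pfMinor pfaffian_fin_add_two pfaffian_mul_mul_transpose det_eq_pfaffian_sq)
open scoped Matrix

noncomputable section

/-! ## §1 The Pfaffian of the skew projection `p̃f(X) = pf(X − Xᵀ)` -/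

section PfaffianSkew

variable {N : ℕ}

/-- The Pfaffian is a continuous function of the matrix (a polynomial in the entries; induction over the Laplace-type
expansion `pfaffian_fin_add_two`). [folklore] -/
private theorem continuous_pfaffian : ∀ {n : ℕ}, Continuous fun A : Matrix (Fin n) (Fin n) ℝ => pfaffian A
  | 0 => continuous_const
  | 1 => continuous_const
  | n + 2 => by
      have ih : Continuous fun A : Matrix (Fin n) (Fin n) ℝ => pfaffian A := continuous_pfaffian
      simp only [pfaffian_fin_add_two]
      refine continuous_finsetSum _ fun j _ => ?_
      refine (continuous_const.mul (continuous_id.matrix_elem 0 j.succ)).mul ?_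
      exact ih.comp (continuous_id.matrix_submatrix _ _)

/-- **`p̃f(g X gᵗ) = det g · p̃f(X)`** for every real `g` (for real matrices `star g = gᵀ`) — «pf(gAgᵗ) = det g pf A …
p̃f(M) = pf(M − Mᵗ) … This is clearly an SO(2k, F) invariant» ([AslaksenTanZhu1995] §1 p.207; the congruence rule is the
tree's `pfaffian_mul_mul_transpose`, Goodman–Wallach (B.15)). [cite: AslaksenTanZhu1995, §1 p.207] -/
theorem pfaffianSkew_conj (g X : Matrix (Fin N) (Fin N) ℝ) :
    pfaffian (g * X * star g - (g * X * star g)ᵀ) = g.det * pfaffian (X - Xᵀ) := by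
  have hs : star g = gᵀ := by
    rw [Matrix.star_eq_conjTranspose, Matrix.conjTranspose_eq_transpose_of_trivial]
  rw [hs, Matrix.transpose_mul, Matrix.transpose_mul, Matrix.transpose_transpose, ← Matrix.mul_assoc,
    show g * X * gᵀ - g * Xᵀ * gᵀ = g * (X - Xᵀ) * gᵀ by rw [Matrix.mul_sub, Matrix.sub_mul]]
  exact pfaffian_mul_mul_transpose (X - Xᵀ) g
    (by rw [Matrix.transpose_sub, Matrix.transpose_transpose, neg_sub]) (fun i => by simp)

end PfaffianSkew

/-! ## §2 The witness `g₀ = J ∈ SO(2m)` with `p̃f(g₀) ≠ 0`, and its reflection `g₁ = P g₀ P` -/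

section Witness

/-- `realJ m` — Mathlib's `Matrix.J (Fin m) ℝ = (0 −I; I 0)` on `Fin m ⊕ Fin m`, re-indexed along
`finSumFinEquiv : Fin m ⊕ Fin m ≃ Fin (m + m)`: a rotation by a quarter turn in `m` orthogonal planes, the standard complex
structure on `ℝ^{2m}` (the matrix `J` of [AslaksenTanZhu1995] Lemma 1, proof p.208, up to sign and ordering).
[cite: AslaksenTanZhu1995, §1 Lemma 1 (proof) p.208] -/
def realJ (m : ℕ) : Matrix (Fin (m + m)) (Fin (m + m)) ℝ :=
  Matrix.reindex finSumFinEquiv finSumFinEquiv (Matrix.J (Fin m) ℝ)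

variable (m : ℕ)

/-- `realJ` is skew-symmetric (Mathlib `Matrix.J_transpose`). [cite: AslaksenTanZhu1995, §1 p.208] -/
theorem realJ_transpose : (realJ m)ᵀ = -realJ m := by
  rw [realJ, Matrix.transpose_reindex, Matrix.J_transpose]
  ext i j
  simp

/-- `realJ² = −1` (Mathlib `Matrix.J_squared`). [cite: AslaksenTanZhu1995, §1 p.208] -/
theorem realJ_mul_realJ : realJ m * realJ m = -1 := by
  rw [realJ, Matrix.reindex_apply, Matrix.submatrix_mul_equiv, Matrix.J_squared]
  ext i j
  simp [Matrix.one_apply]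

/-- `realJ` is real orthogonal: `J Jᵀ = J(−J) = 1`. [cite: AslaksenTanZhu1995, §1 p.208] -/
theorem realJ_mem_orthogonalGroup : realJ m ∈ Matrix.orthogonalGroup (Fin (m + m)) ℝ := by
  rw [Matrix.mem_unitaryGroup_iff, Matrix.star_eq_conjTranspose, Matrix.conjTranspose_eq_transpose_of_trivial,
    realJ_transpose, Matrix.mul_neg, realJ_mul_realJ, neg_neg]

/-- `det realJ = 1` (Mathlib: symplectic matrices have determinant one, `SymplecticGroup.det_eq_one`, applied to
`J ∈ Sp(2m, ℝ)`). [cite: AslaksenTanZhu1995, §1 p.208] -/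
theorem det_realJ : (realJ m).det = 1 := by
  rw [realJ, Matrix.det_reindex_self]
  exact SymplecticGroup.det_eq_one (SymplecticGroup.J_mem (Fin m) ℝ)

/-- `realJ ∈ SO(2m)`. [cite: AslaksenTanZhu1995, §1 p.208] -/
theorem realJ_mem_specialOrthogonalGroup : realJ m ∈ Matrix.specialOrthogonalGroup (Fin (m + m)) ℝ :=
  Matrix.mem_specialUnitaryGroup_iff.mpr ⟨realJ_mem_orthogonalGroup m, det_realJ m⟩

/-- **`p̃f(J) = pf(J − Jᵀ) = pf(2J) ≠ 0`**: `det(2J) = 2^{2m} det J ≠ 0` and «det A = pf² A» (tree's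
`det_eq_pfaffian_sq`, Cayley). [cite: AslaksenTanZhu1995, §1 p.207] -/
theorem pfaffianSkew_realJ_ne_zero : pfaffian (realJ m - (realJ m)ᵀ) ≠ 0 := by
  have h2 : realJ m - (realJ m)ᵀ = (2 : ℝ) • realJ m := by rw [realJ_transpose, sub_neg_eq_add, two_smul]
  have hskew : ((2 : ℝ) • realJ m)ᵀ = -((2 : ℝ) • realJ m) := by
    rw [Matrix.transpose_smul, realJ_transpose, smul_neg]
  have hdiag : ∀ i, ((2 : ℝ) • realJ m) i i = 0 := fun i => by
    have h := congrFun (congrFun hskew i) i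
    rw [Matrix.transpose_apply, Matrix.neg_apply] at h
    linarith
  have hdet : ((2 : ℝ) • realJ m).det = pfaffian ((2 : ℝ) • realJ m) ^ 2 := det_eq_pfaffian_sq _ hskew hdiag
  rw [h2]
  intro h0
  rw [h0, Matrix.det_smul, det_realJ, mul_one, Fintype.card_fin, zero_pow two_ne_zero] at hdet
  exact pow_ne_zero _ two_ne_zero hdet

/-- The coordinate reflection `P_i = diag(1, …, −1, …, 1)` (`−1` in position `i`), an element of `O(N) ∖ SO(N)`.
[cite: AslaksenTanZhu1995, §1 p.207] -/
def negAt {N : ℕ} (i : Fin N) : Matrix (Fin N) (Fin N) ℝ := Matrix.diagonal fun a => if a = i then -1 else 1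

variable {N : ℕ} (i : Fin N)

/-- `P_i² = 1`. [cite: AslaksenTanZhu1995, §1 p.207] -/
theorem negAt_mul_negAt : negAt i * negAt i = 1 := by
  rw [negAt, Matrix.diagonal_mul_diagonal, ← Matrix.diagonal_one]
  congr 1
  funext a
  split_ifs <;> norm_num

/-- `P_iᵀ = P_i` and hence `star P_i = P_i`. [cite: AslaksenTanZhu1995, §1 p.207] -/
theorem star_negAt : star (negAt i) = negAt i := by
  rw [Matrix.star_eq_conjTranspose, Matrix.conjTranspose_eq_transpose_of_trivial, negAt, Matrix.diagonal_transpose]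

/-- `P_i ∈ O(N)`. [cite: AslaksenTanZhu1995, §1 p.207] -/
theorem negAt_mem_orthogonalGroup : negAt i ∈ Matrix.orthogonalGroup (Fin N) ℝ := by
  rw [Matrix.mem_unitaryGroup_iff, star_negAt, negAt_mul_negAt]

/-- `det P_i = −1`. [cite: AslaksenTanZhu1995, §1 p.207] -/
theorem det_negAt : (negAt i).det = -1 := by
  rw [negAt, Matrix.det_diagonal, Finset.prod_ite_eq']
  simp

/-- The one-letter family `g₀ = J` in `SO(2m)` (index type `Unit`). [cite: AslaksenTanZhu1995, §1 p.207] -/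
def baseFamily : Unit → Matrix.specialOrthogonalGroup (Fin (m + m)) ℝ :=
  fun _ => ⟨realJ m, realJ_mem_specialOrthogonalGroup m⟩

/-- `P J P ∈ SO(2m)` for the reflection `P = P_{i₀}` (orthogonal; `det = (−1)·1·(−1) = 1`). [cite: AslaksenTanZhu1995, §1 p.207] -/
theorem refl_mem_specialOrthogonalGroup (i₀ : Fin (m + m)) :
    negAt i₀ * realJ m * negAt i₀ ∈ Matrix.specialOrthogonalGroup (Fin (m + m)) ℝ := by
  refine Matrix.mem_specialUnitaryGroup_iff.mpr ⟨?_, ?_⟩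
  · exact Submonoid.mul_mem _ (Submonoid.mul_mem _ (negAt_mem_orthogonalGroup i₀) (realJ_mem_orthogonalGroup m))
      (negAt_mem_orthogonalGroup i₀)
  · rw [Matrix.det_mul, Matrix.det_mul, det_negAt, det_realJ]
    norm_num

/-- The reflected one-letter family `g₁ = P J P` in `SO(2m)`, `P = P_{i₀} ∈ O(2m) ∖ SO(2m)` («reflection conjugation»).
[cite: AslaksenTanZhu1995, §1 p.207] -/
def reflFamily (i₀ : Fin (m + m)) : Unit → Matrix.specialOrthogonalGroup (Fin (m + m)) ℝ :=
  fun _ => ⟨negAt i₀ * realJ m * negAt i₀, refl_mem_specialOrthogonalGroup m i₀⟩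

/-- **`g₀ = J` and `g₁ = P J P` HAVE THE SAME TRACES OF ALL WORDS** in the natural representation: they are conjugate by
`P` inside `O(2m)`, and word traces are class functions there. [cite: Sengupta1994, Thm 2 p.900] -/
theorem tracePart_wordVal_reflFamily (i₀ : Fin (m + m)) (w : List (Unit × Bool)) (b : Bool) :
    tracePart (specialOrthogonalRep (Fin (m + m))) b (wordVal w (baseFamily m)) =
      tracePart (specialOrthogonalRep (Fin (m + m))) b (wordVal w (reflFamily m i₀)) := by
  have hle : Matrix.specialOrthogonalGroup (Fin (m + m)) ℝ ≤ Matrix.orthogonalGroup (Fin (m + m)) ℝ :=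
    Matrix.specialUnitaryGroup_le_unitaryGroup
  let incl : Matrix.specialOrthogonalGroup (Fin (m + m)) ℝ →* Matrix.orthogonalGroup (Fin (m + m)) ℝ :=
    { toFun := fun g => ⟨g, hle g.2⟩
      map_one' := rfl
      map_mul' := fun _ _ => rfl }
  have hρ : ∀ g, orthogonalRep (Fin (m + m)) (incl g) = specialOrthogonalRep (Fin (m + m)) g := fun g => rfl
  have hword : ∀ (U : Unit → Matrix.specialOrthogonalGroup (Fin (m + m)) ℝ),
      wordVal w (fun i => incl (U i)) = incl (wordVal w U) := fun U => by
    classical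
    rw [TraceWordsSeparateOrbitsUnitary.wordVal_eq_freeGroup_lift, TraceWordsSeparateOrbitsUnitary.wordVal_eq_freeGroup_lift,
      ← MonoidHom.comp_apply]
    congr 1
    ext i
    simp
  have htransfer : ∀ (U : Unit → Matrix.specialOrthogonalGroup (Fin (m + m)) ℝ),
      tracePart (specialOrthogonalRep (Fin (m + m))) b (wordVal w U) =
        tracePart (orthogonalRep (Fin (m + m))) b (wordVal w fun i => incl (U i)) := fun U => by
    rw [hword]
    cases b <;> simp only [tracePart, hρ]
  -- the reflection as an element of `O(2m)`, equal to its own inverse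
  let P : Matrix.orthogonalGroup (Fin (m + m)) ℝ := ⟨negAt i₀, negAt_mem_orthogonalGroup i₀⟩
  have hPinv : P⁻¹ = P := Subtype.ext (star_negAt i₀)
  have hW : (fun i => incl (reflFamily m i₀ i)) = fun i => P * incl (baseFamily m i) * P⁻¹ := by
    funext i
    rw [hPinv]
    rfl
  rw [htransfer, htransfer, hW, wordVal_conj, tracePart_conj]

end Witness

/-! ## §3 `SO(2m)`: word traces do NOT separate simultaneous-conjugation orbits -/

section Negatives

/-- **CENSUS NEGATIVE — `SO(2m)`, `m ≥ 1`: module XXI's schema FAILS for the natural representation**,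
`¬ TraceWordsSeparateOrbits (specialOrthogonalRep (Fin (m+m)))`.  One letter suffices: `g₀ = J` and `g₁ = P J P` have the
same traces of all words (`tracePart_wordVal_reflFamily`) but are not conjugate in `SO(2m)` — a conjugator `k ∈ SO(2m)`
would give `p̃f(g₁) = det k · p̃f(g₀) = p̃f(g₀)`, whereas `p̃f(g₁) = det P · p̃f(g₀) = −p̃f(g₀) ≠ p̃f(g₀)`
(`pfaffianSkew_realJ_ne_zero`).  The invariant `p̃f` is [AslaksenTanZhu1995]'s «clearly an SO(2k, F) invariant» that the
traces miss; this is why [Sengupta1994] Thm 2 lists only «the odd special orthogonal groups SO(2n+1)».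
[cite: AslaksenTanZhu1995, §1 p.207 and Thm 3 p.209] -/
theorem not_traceWordsSeparateOrbits_specialOrthogonalGroup_add_self (m : ℕ) (hm : 1 ≤ m) :
    ¬ TraceWordsSeparateOrbits (specialOrthogonalRep (Fin (m + m))) := by
  intro hsep
  let i₀ : Fin (m + m) := ⟨0, by omega⟩
  obtain ⟨k, hk⟩ := hsep Unit (baseFamily m) (reflFamily m i₀) (fun w b => tracePart_wordVal_reflFamily m i₀ w b)
  have hk0 := congrArg (Subtype.val : Matrix.specialOrthogonalGroup (Fin (m + m)) ℝ → Matrix (Fin (m + m)) (Fin (m + m)) ℝ)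
    (hk ())
  rw [← Matrix.star_eq_inv] at hk0
  change negAt i₀ * realJ m * negAt i₀ =
    (k : Matrix (Fin (m + m)) (Fin (m + m)) ℝ) * realJ m * star (k : Matrix (Fin (m + m)) (Fin (m + m)) ℝ) at hk0
  have hkdet : (k : Matrix (Fin (m + m)) (Fin (m + m)) ℝ).det = 1 := (Matrix.mem_specialUnitaryGroup_iff.mp k.2).2
  -- apply `p̃f` to both sides
  have hpf := congrArg (fun X : Matrix (Fin (m + m)) (Fin (m + m)) ℝ => pfaffian (X - Xᵀ)) hk0
  rw [pfaffianSkew_conj, hkdet, one_mul, ← star_negAt i₀] at hpf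
  conv_lhs at hpf => rw [star_negAt i₀, show negAt i₀ * realJ m * negAt i₀ = negAt i₀ * realJ m * star (negAt i₀) by
    rw [star_negAt]]
  rw [pfaffianSkew_conj, det_negAt] at hpf
  have hc := pfaffianSkew_realJ_ne_zero m
  apply hc
  linarith

/-- **`SO(N)`, `N` EVEN, `N ≥ 2`: `¬ TraceWordsSeparateOrbits (specialOrthogonalRep (Fin N))`** (the even case left open by
`traceWordsSeparateOrbits_specialOrthogonalGroup (hN : Odd N)` of the companion file is FALSE, for every even `N ≥ 2`).
[cite: AslaksenTanZhu1995, Thm 3 p.209] -/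
theorem not_traceWordsSeparateOrbits_specialOrthogonalGroup_even {N : ℕ} (hN : Even N) (h2 : 2 ≤ N) :
    ¬ TraceWordsSeparateOrbits (specialOrthogonalRep (Fin N)) := by
  obtain ⟨m, rfl⟩ := hN
  exact not_traceWordsSeparateOrbits_specialOrthogonalGroup_add_self m (by omega)

/-! ## §4 `SO(2m)`: the density schema `TraceWordsDense` fails -/

/-- Every element of the span of the trace-word products takes the same value at `g₀` and at `g₁` (each factor does,
`tracePart_wordVal_reflFamily`). [cite: AslaksenTanZhu1995, §1 p.207] -/
private theorem span_apply_eq (m : ℕ) (i₀ : Fin (m + m)) {p : (Unit → Matrix.specialOrthogonalGroup (Fin (m + m)) ℝ) → ℝ}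
    (hp : p ∈ Submodule.span ℝ (traceWordProducts (specialOrthogonalRep (Fin (m + m))) Unit)) :
    p (baseFamily m) = p (reflFamily m i₀) := by
  induction hp using Submodule.span_induction with
  | mem q hq =>
      obtain ⟨l, rfl⟩ := hq
      simp only [traceWordProduct, tracePart_wordVal_reflFamily m i₀]
  | zero => rfl
  | add q r _ _ hq hr => simp only [Pi.add_apply, hq, hr]
  | smul c q _ hq => simp only [Pi.smul_apply, hq]

/-- **CENSUS NEGATIVE — `SO(2m)`, `m ≥ 1`: module XX's density schema FAILS for the natural representation**,
`¬ TraceWordsDense (specialOrthogonalRep (Fin (m+m)))`: the continuous, simultaneous-conjugation-invariant function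
`V ↦ p̃f(V) = pf(V − Vᵀ)` on `SO(2m)^{Unit}` («clearly an SO(2k, F) invariant») equals `c ≠ 0` at `g₀` and `−c` at `g₁`,
where every polynomial in the word traces takes equal values; so it is not within `|c|/2` of any of them.  (With the
polarized Pfaffians ADDED the invariants are generated, [AslaksenTanZhu1995] Thm 3 — not formalised.)
[cite: AslaksenTanZhu1995, §1 p.207 and Thm 3 p.209] -/
theorem not_traceWordsDense_specialOrthogonalGroup_add_self (m : ℕ) (hm : 1 ≤ m) :
    ¬ TraceWordsDense (specialOrthogonalRep (Fin (m + m))) := by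
  intro hdense
  let i₀ : Fin (m + m) := ⟨0, by omega⟩
  let f : (Unit → Matrix.specialOrthogonalGroup (Fin (m + m)) ℝ) → ℝ := fun V =>
    pfaffian (((V ()) : Matrix (Fin (m + m)) (Fin (m + m)) ℝ) - ((V ()) : Matrix (Fin (m + m)) (Fin (m + m)) ℝ)ᵀ)
  have hval : Continuous fun V : Unit → Matrix.specialOrthogonalGroup (Fin (m + m)) ℝ =>
      ((V ()) : Matrix (Fin (m + m)) (Fin (m + m)) ℝ) := continuous_subtype_val.comp (continuous_apply ())
  have hf : Continuous f := continuous_pfaffian.comp (hval.sub hval.matrix_transpose)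
  have hfinv : ∀ (g : Matrix.specialOrthogonalGroup (Fin (m + m)) ℝ) (V : Unit → Matrix.specialOrthogonalGroup (Fin (m + m)) ℝ),
      f (fun i => g * V i * g⁻¹) = f V := by
    intro g V
    have hgdet : (g : Matrix (Fin (m + m)) (Fin (m + m)) ℝ).det = 1 := (Matrix.mem_specialUnitaryGroup_iff.mp g.2).2
    change pfaffian (((g * V () * g⁻¹ : Matrix.specialOrthogonalGroup (Fin (m + m)) ℝ) : Matrix (Fin (m + m)) (Fin (m + m)) ℝ)
        - ((g * V () * g⁻¹ : Matrix.specialOrthogonalGroup (Fin (m + m)) ℝ) : Matrix (Fin (m + m)) (Fin (m + m)) ℝ)ᵀ) =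
      pfaffian (((V ()) : Matrix (Fin (m + m)) (Fin (m + m)) ℝ) - ((V ()) : Matrix (Fin (m + m)) (Fin (m + m)) ℝ)ᵀ)
    rw [← Matrix.star_eq_inv, Submonoid.coe_mul, Submonoid.coe_mul, Matrix.specialUnitaryGroup.coe_star,
      pfaffianSkew_conj, hgdet, one_mul]
  set c : ℝ := pfaffian (realJ m - (realJ m)ᵀ) with hcdef
  have hc : c ≠ 0 := pfaffianSkew_realJ_ne_zero m
  have hfV : f (baseFamily m) = c := rfl
  have hfW : f (reflFamily m i₀) = -c := by
    change pfaffian (negAt i₀ * realJ m * negAt i₀ - (negAt i₀ * realJ m * negAt i₀)ᵀ) = -c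
    conv_lhs => rw [← star_negAt i₀, star_negAt i₀,
      show negAt i₀ * realJ m * negAt i₀ = negAt i₀ * realJ m * star (negAt i₀) by rw [star_negAt]]
    rw [pfaffianSkew_conj, det_negAt, hcdef]
    ring
  obtain ⟨p, hp, hclose⟩ := hdense Unit f hf hfinv (|c| / 2) (by positivity)
  have h1 := hclose (baseFamily m)
  have h2 := hclose (reflFamily m i₀)
  rw [hfV] at h1
  rw [hfW, ← span_apply_eq m i₀ hp] at h2
  have h3 : |c - (-c)| ≤ |c| / 2 + |c| / 2 := by
    calc |c - (-c)| = |(c - p (baseFamily m)) - (-c - p (baseFamily m))| := by ring_nf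
      _ ≤ |c - p (baseFamily m)| + |(-c) - p (baseFamily m)| := abs_sub _ _
      _ ≤ |c| / 2 + |c| / 2 := add_le_add h1 h2
  have h4 : |c - (-c)| = 2 * |c| := by
    rw [sub_neg_eq_add, ← two_mul, abs_mul, abs_two]
  have h5 : |c| ≤ 0 := by linarith
  exact hc (abs_eq_zero.mp (le_antisymm h5 (abs_nonneg c)))

/-- **`SO(N)`, `N` EVEN, `N ≥ 2`: `¬ TraceWordsDense (specialOrthogonalRep (Fin N))`** — polynomials in the natural-
representation word traces are NOT dense in the continuous conjugation-invariant functions on `SO(N)^ι` (already for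
one letter). [cite: AslaksenTanZhu1995, Thm 3 p.209] -/
theorem not_traceWordsDense_specialOrthogonalGroup_even {N : ℕ} (hN : Even N) (h2 : 2 ≤ N) :
    ¬ TraceWordsDense (specialOrthogonalRep (Fin N)) := by
  obtain ⟨m, rfl⟩ := hN
  exact not_traceWordsDense_specialOrthogonalGroup_add_self m (by omega)

end Negatives

end

end Literature.MathematicalPhysics.QuantumFieldTheory.Balaban1983to89.TraceWordsSeparateOrbitsEvenOrthogonal
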